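import Literature.Geometry.Kaehler.ComplexTorusHodgeGroupHodgeCircleSigmaPiHomClasses
import Literature.Geometry.Kaehler.ComplexTorusHodgeGroupProductNonCMEllipticCurve
import Literature.Geometry.Kaehler.ComplexTorusHodgeGroupIsotropyCommutative
import Literature.Geometry.Kaehler.ComplexTorusHodgeClassesProductHodgeGroup
import Literature.Geometry.Kaehler.ComplexTorusIntegralHodgeClassesProduct
import HarnessLib

/-!
# A one-dimensional torus WITHOUT complex multiplication times an arbitrary finite product of tori on the
# Hodge-circle locus: `Hg(E × ∏ₖ X_k)(ℝ) = SL₂(ℝ) × Hg(∏ₖ X_k)(ℝ) = {(M 0; 0 diag_k(h_k(e^{iθ_{d(k)}})))}`, the Künneth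
# count `dim B^{p+1}(E × ∏ₖ X_k) = dim B^{p+1}(∏ₖ X_k) + dim B^p(∏ₖ X_k)` and `D = B` (Imai 1976, §2 Proposition, last
# case, and §3 Remarks; Moonen–Zarhin 1999, §3 Theorem (Hazama) (2))

Layer `Literature/Geometry/Kaehler`, namespace `Literature.Geometry.Kaehler.ComplexTorus`; lane `lit-hodgefound`
(Track 2 foundations library), Layer A3/A4 (Hodge groups of products, Hodge classes); prover seat `lit-hodgefound-p17`
(generation 35, self-proposed row g35-#2 = FREE POINTER (ρ) of the gen-34 HANDOFF, the MIXED family with one factor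
without complex multiplication). Sequel, BY NAME and without restating anything, of g35-#1
`ComplexTorusHodgeGroupHodgeCircleSigmaPiHomClasses` (`Hg(∏ₖ X_k)(ℝ)` on elements for any finite family on the locus,
`mem_hodgeGroup_sigmaPiPeriod_iff_exists_of_homColouring`), of p22's `ComplexTorusHodgeGroupProductNonCMEllipticCurve`
(Imai's mixed case for two factors: `hodgeGroup_prod_eq_of_endAlgRat_eq_bot` — `Hg(E × X₂) = SL₂ × Hg(X₂)` for
`End_ℚ(E) = ℚ` and `Hg(X₂)(ℂ)` commutative; `hodgeGroup_eq_top_of_endAlgRat_eq_bot`), of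
`ComplexTorusHodgeGroupIsotropyCommutative` (`hodgeGroupC_comm_of_hodgeGroup_comm`), of g33-#5
(`hodgeGroup_sigmaPiPeriod_comm_of_coe_eq_range`), of the Künneth file `ComplexTorusHodgeClassesProductHodgeGroup` §7
(`finrank_hodgeClasses_prod_succ_of_endAlgRat_eq_bot` — `dim B^{p+1}(E × X₂) = dim B^{p+1}(X₂) + dim B^p(X₂)` — and
`forall_divisorClasses_prod_eq_hodgeClasses_of_endAlgRat_eq_bot`, both under `Hg(X₂)(ℂ)` commutative, discharged here on
the locus), of g34-#1 (`finrank_hodgeClasses_sigmaPiPeriod_eq_sum_of_homColouring`) and of g33-#8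
(`divisorClasses_sigmaPiPeriod_eq_hodgeClasses_of_coe_eq_range`). THEOREMS ONLY (no definition, no instance, no named
fact; D-0026 net debt 0).

## Sources, verbatim

* H. Imai, *On the Hodge groups of some abelian varieties*, Kōdai Math. Sem. Rep. 27 (1976) (held
  `paper:doi-10-2996-kmj-1138847263`), §2 (p0002 L5–L7): "It is well known that `Hg(E)` is a 1-dimensional torus if `E`
  is of CM-type […], and that `Hg(E) = SL₂` if `E` is not of CM-type"; §2 Proposition, proof, last case (p0004 = p. 370
  L10–L19): "Lastly suppose `E₁, ⋯, E_m` are of CM-type and `E_{m+1}, ⋯, E_n` are not of CM-type. Write `H = H′·D` as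
  before. Denote by `p` (`q` resp.) the projection to `1 × ⋯ × m` factor (`m+1 × ⋯ × n` factor resp.). Then
  `p(D) = p(H) = Hg(E₁ × ⋯ × E_m)` […] Therefore we have `H = H₁ × ⋯ × H_n`."; §3 Remarks (p0004 L31–L40, p0005 L5–L7):
  "For the product of elliptic curves (isogenous or not), its Hodge group can be obtained as follows […]
  `Hg(∏_{i,j} E_i^{(j)}) ≅ ∏ᵢ Δ_{m_i}(Hg(E_i^{(1)}))` […] Let `E_i^{(j)}` be as above and let `E` be another elliptic
  curve. […] In the case when `E` is non-isogenous to any `E_i^{(j)}`, the case when `m_i = 1` (`i = 1, ⋯, n`) has been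
  proved in the proposition and the case when some `m_i > 1` may be reduced to the above case".
* B. Moonen, Yu. Zarhin, *Hodge classes on abelian varieties of low dimension*, Math. Ann. 315 (1999) (held
  `paper:arxiv-math_9901113`), §3 (p0006 L64–L77): "we have the following result of Hazama. **Theorem.** […] (2) Suppose
  `X₁` has no factors of Type IV and `X₂` is of CM-type. Then `X₁ × X₂` again satisfies (D) and
  `Hg(X₁ × X₂) = Hg(X₁) × Hg(X₂)`."; §3 (3.1) (p0006 L25–L28): "`Hg(X) = Hg(X₁) × Hg(X₂)` ⟺ `ℬ•(X₁ⁿ × X₂ᵐ) = ℬ•(X₁ⁿ) ⊗ ℬ•(X₂ᵐ)`".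
* B. B. Gordon, *A survey of the Hodge conjecture for abelian varieties* (1997), §3 Theorem (p0013 L55–L62, L84–L90):
  "`Hdg(A) = Hdg(B) ⊗ Hdg(C)` […] `dim Hdg(A) = dim Hdg(B) · dim Hdg(C)`".
* C. Voisin, *Hodge Theory and Complex Algebraic Geometry I* (2002), §11.3.3 Thm. 11.38 (Künneth components of Hodge classes).
* H. Lange, *Abelian Varieties over the Complex Numbers* (2023), §7.2.1 (p. 329), §7.3.1, §7.3.3 Exercises (2), (3)(b).

## What is proved (`E = ℂ/Φ₀(ℤ²)` with `End_ℚ(E) = ℚ`; `X_k = F_k/Ψ_k(ℤ^{σ k})` on the locus, `g_k ≥ 1`; real points)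

* §1 **`Hg(∏ₖ X_k)(ℂ)` is commutative** for every finite family on the locus (`hodgeGroupC_sigmaPiPeriod_comm_of_coe_eq_range`);
  **`Hg(E × ∏ₖ X_k)(ℝ) = SL₂(ℝ) × Hg(∏ₖ X_k)(ℝ)`** (`hodgeGroup_prod_sigmaPiPeriod_eq_of_endAlgRat_eq_bot`, Hazama / Imai
  BY NAME); `prod_le_hodgeGroup_prod_sigmaPiPeriod_of_endAlgRat_eq_bot` (the Künneth hypothesis shape).
* §2 **ON ELEMENTS, with a `Hom`-colouring `d : κ ↠ R` of the locus factors: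
  `P ∈ Hg(E × ∏ₖ X_k)(ℝ) ⟺ P = (M 0; 0 diag_k(h_k(e^{iθ_{d(k)}})))`, `M ∈ SL₂(ℝ)` ARBITRARY, `θ ∈ ℝ^R`**
  (`mem_hodgeGroup_prod_sigmaPiPeriod_iff_exists_of_homColouring`; Imai's `SL₂ × ∏ᵢ Δ_{m_i}(U(1))` for tori of any
  dimension), the colouring-free form `mem_hodgeGroup_prod_sigmaPiPeriod_iff_exists_of_coe_eq_range`, and
  `blockDiag_mem_hodgeGroup_prod_sigmaPiPeriod_iff` (a block-diagonal `(M, diag(h_k(e^{iθ_k})))` lies in `Hg` iff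
  `e^{iθ_k} = e^{iθ_l}` whenever `Hom_ℚ(X_k, X_l) ≠ 0` — no condition on `M`).
* §3 **HODGE CLASSES**: the Poincaré series **`P_{E × X₂}(t) = (1 + t) · P_{X₂}(t)`** for `End_ℚ(E) = ℚ` and
  `Hg(X₂)(ℂ)` commutative (`hodgePoincare_prod_of_endAlgRat_eq_bot`, from the tree's Künneth-with-a-curve count); for the
  mixed family **`dim B^{p+1}(E × ∏ₖ X_k) = dim B^{p+1}(∏ₖ X_k) + dim B^p(∏ₖ X_k)`**, with a colouring
  `= Σ_{Σf = p+1} ∏ᵢ C(nᵢ, fᵢ)² + Σ_{Σf = p} ∏ᵢ C(nᵢ, fᵢ)²` (`nᵢ = Σ_{d k = i} g_k`), `P_{E × ∏ X_k}(t) = (1 + t) · P_{∏ X_k}(t)`,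
  and **`D = B` (Tate) for `E × ∏ₖ X_k`** (`forall_divisorClasses_prod_sigmaPiPeriod_eq_hodgeClasses`); §4 the `E_τ`
  specialisations (`End(E_τ) = ℤ`).

## References

* [Imai1976HodgeGroups] H. Imai, Kōdai Math. Sem. Rep. 27 (1976) 367–372, §2 Proposition (pp. 368, 370), §3 Remarks (p. 370).
* [MoonenZarhin1999LowDim] B. Moonen, Yu. Zarhin, Math. Ann. 315 (1999), §3 Theorem (2) and (3.1), §3 Corollary.
* [Gordon1997] B. B. Gordon, *A survey of the Hodge conjecture for abelian varieties*, §3 Theorem and its proof.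
* [VoisinHodgeI2002] C. Voisin, *Hodge Theory and Complex Algebraic Geometry I* (2002), §11.3.3 Thm. 11.38.
* [Lange2023AbelianVarietiesComplex] H. Lange (2023), §7.2.1, §7.3.1, §7.3.3 Exercises (2), (3)(b).
* [CarlsonMullerStachPeters2017] J. Carlson, S. Müller-Stach, C. Peters (2017), §15.2 Examples 15.2.4 (ii).
-/

noncomputable section

open scoped Real MatrixGroups
open Set Function Complex Module Matrix

namespace Literature.Geometry.Kaehler

namespace ComplexTorus

/-! ## §1 `Hg(E × ∏ₖ X_k)(ℝ) = SL₂(ℝ) × Hg(∏ₖ X_k)(ℝ)` -/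

section Split

variable (Φ₀ : (Fin 2 → ℝ) ≃L[ℝ] ℂ)
  {κ : Type*} [Fintype κ] [DecidableEq κ] {σ : κ → Type*} [∀ k, Fintype (σ k)] [∀ k, DecidableEq (σ k)]
  {F : κ → Type*} [∀ k, NormedAddCommGroup (F k)] [∀ k, NormedSpace ℂ (F k)]
  (Ψ : ∀ k, (σ k → ℝ) ≃L[ℝ] F k)

/-- **`Hg(∏ₖ X_k)(ℂ)` IS COMMUTATIVE for every finite family of tori on the Hodge-circle locus** (the real points are
commutative, g33-#5, and commutativity passes to complex points — every finite product of tori on the locus is of CM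
type). [cite: Imai1976HodgeGroups, §2 (p. 368 L5–L7)] [cite: MoonenZarhin1999LowDim, §3 Theorem (2) ("`X₂` is of CM-type")] -/
theorem hodgeGroupC_sigmaPiPeriod_comm_of_coe_eq_range
    (h : ∀ k, (hodgeGroup (Ψ k) : Set (SpecialLinearGroup (σ k) ℝ)) = Set.range (hodgeCircleSL (Ψ k)))
    {A B : SpecialLinearGroup (Σ k, σ k) ℂ} (hA : A ∈ hodgeGroupC (sigmaPiPeriod Ψ))
    (hB : B ∈ hodgeGroupC (sigmaPiPeriod Ψ)) : A * B = B * A :=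
  hodgeGroupC_comm_of_hodgeGroup_comm (sigmaPiPeriod Ψ)
    (fun _ hM _ hN ↦ hodgeGroup_sigmaPiPeriod_comm_of_coe_eq_range Ψ h hM hN) hA hB

/-- **HAZAMA'S THEOREM / IMAI'S PROPOSITION (last case) FOR THE MIXED FAMILY: `Hg(E × ∏ₖ X_k)(ℝ) = SL₂(ℝ) × Hg(∏ₖ X_k)(ℝ)`**
(block-diagonally in `SL(H₁(E × ∏ₖ X_k, ℝ))`) for a one-dimensional torus `E` with `End_ℚ(E) = ℚ` and any finite family
of tori `X_k` on the Hodge-circle locus («Suppose `X₁` has no factors of Type IV and `X₂` is of CM-type. Then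
`Hg(X₁ × X₂) = Hg(X₁) × Hg(X₂)`»; `Hg(E)(ℝ) = SL₂(ℝ)`). [cite: MoonenZarhin1999LowDim, §3 Theorem (2) (p0006 L70–L76)]
[cite: Imai1976HodgeGroups, §2 Proposition, proof, last case (p. 370 L10–L19) and §3 Remarks (p. 370 L38–L40, p. 371 L5–L7)] -/
theorem hodgeGroup_prod_sigmaPiPeriod_eq_of_endAlgRat_eq_bot (hE : endAlgRat Φ₀ = ⊥)
    (h : ∀ k, (hodgeGroup (Ψ k) : Set (SpecialLinearGroup (σ k) ℝ)) = Set.range (hodgeCircleSL (Ψ k))) :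
    hodgeGroup (prodPeriod Φ₀ (sigmaPiPeriod Ψ)) =
      ((hodgeGroup Φ₀).prod (hodgeGroup (sigmaPiPeriod Ψ))).map (blockDiag (Fin 2) (Σ k, σ k)) :=
  hodgeGroup_prod_eq_of_endAlgRat_eq_bot Φ₀ (sigmaPiPeriod Ψ) hE fun _ _ hM hN ↦
    congrArg Subtype.val (hodgeGroupC_sigmaPiPeriod_comm_of_coe_eq_range Ψ h hM hN)

/-- … in particular `Hg(E)(ℝ) × Hg(∏ₖ X_k)(ℝ) ≤ Hg(E × ∏ₖ X_k)(ℝ)` (the hypothesis shape of the tree's Künneth theorems).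
[cite: MoonenZarhin1999LowDim, §3 Theorem (2) and (3.1)] -/
theorem prod_le_hodgeGroup_prod_sigmaPiPeriod_of_endAlgRat_eq_bot (hE : endAlgRat Φ₀ = ⊥)
    (h : ∀ k, (hodgeGroup (Ψ k) : Set (SpecialLinearGroup (σ k) ℝ)) = Set.range (hodgeCircleSL (Ψ k))) :
    ((hodgeGroup Φ₀).prod (hodgeGroup (sigmaPiPeriod Ψ))).map (blockDiag (Fin 2) (Σ k, σ k)) ≤
      hodgeGroup (prodPeriod Φ₀ (sigmaPiPeriod Ψ)) :=
  (hodgeGroup_prod_sigmaPiPeriod_eq_of_endAlgRat_eq_bot Φ₀ Ψ hE h).ge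

/-- **Every `(M 0; 0 Q)` with `M ∈ SL₂(ℝ)` ARBITRARY and `Q ∈ Hg(∏ₖ X_k)(ℝ)` lies in `Hg(E × ∏ₖ X_k)(ℝ)`** (`Hg(E) = SL₂` for
`E` without complex multiplication). [cite: Imai1976HodgeGroups, §2 (p. 368 L5–L7) and Proposition (p. 370)]
[cite: MoonenZarhin1999LowDim, §3 Theorem (2)] -/
theorem blockDiag_mem_hodgeGroup_prod_sigmaPiPeriod_of_mem (hE : endAlgRat Φ₀ = ⊥)
    (h : ∀ k, (hodgeGroup (Ψ k) : Set (SpecialLinearGroup (σ k) ℝ)) = Set.range (hodgeCircleSL (Ψ k)))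
    (M : SL(2, ℝ)) {Q : SpecialLinearGroup (Σ k, σ k) ℝ} (hQ : Q ∈ hodgeGroup (sigmaPiPeriod Ψ)) :
    blockDiag (Fin 2) (Σ k, σ k) (M, Q) ∈ hodgeGroup (prodPeriod Φ₀ (sigmaPiPeriod Ψ)) := by
  refine prod_le_hodgeGroup_prod_sigmaPiPeriod_of_endAlgRat_eq_bot Φ₀ Ψ hE h (Subgroup.mem_map.2 ⟨(M, Q), ?_, rfl⟩)
  rw [Subgroup.mem_prod, hodgeGroup_eq_top_of_endAlgRat_eq_bot Φ₀ hE]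
  exact ⟨Subgroup.mem_top M, hQ⟩

end Split

/-! ## §2 On elements: `P = (M 0; 0 diag_k(h_k(e^{iθ_{d(k)}})))`, `M ∈ SL₂(ℝ)` arbitrary -/

section Elements

variable (Φ₀ : (Fin 2 → ℝ) ≃L[ℝ] ℂ)
  {κ : Type*} [Fintype κ] [DecidableEq κ] {σ : κ → Type*} [∀ k, Fintype (σ k)] [∀ k, DecidableEq (σ k)]
  {F : κ → Type*} [∀ k, NormedAddCommGroup (F k)] [∀ k, NormedSpace ℂ (F k)] [∀ k, FiniteDimensional ℂ (F k)]
  (Ψ : ∀ k, (σ k → ℝ) ≃L[ℝ] F k) {R : Type*} [Fintype R] [DecidableEq R] {d : κ → R}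

/-- **IMAI'S MIXED CASE ON ELEMENTS, FOR TORI OF ANY DIMENSION ON THE LOCUS: with a `Hom`-colouring `d : κ ↠ R` of the
locus factors (`d k = d l ⟺ Hom_ℚ(X_k, X_l) ≠ 0`), `P ∈ Hg(E × ∏ₖ X_k)(ℝ) ⟺ P = (M 0; 0 diag_k(h_k(e^{iθ_{d(k)}})))` for
some `M ∈ SL₂(ℝ)` and `θ : R → ℝ`** — the group `SL₂ × ∏ᵢ Δ_{m_i}(U(1))` of Imai's §3 Remarks («`E` non-isogenous to any
`E_i^{(j)}`»), `E` without complex multiplication. [cite: Imai1976HodgeGroups, §3 Remarks (p. 370 L31–L40, p. 371 L5–L7)]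
[cite: MoonenZarhin1999LowDim, §3 Theorem (2) and Corollary] -/
theorem mem_hodgeGroup_prod_sigmaPiPeriod_iff_exists_of_homColouring (hE : endAlgRat Φ₀ = ⊥)
    (hg : ∀ k, 0 < finrank ℂ (F k))
    (h : ∀ k, (hodgeGroup (Ψ k) : Set (SpecialLinearGroup (σ k) ℝ)) = Set.range (hodgeCircleSL (Ψ k)))
    (hd : ∀ k l, d k = d l ↔ homRat (Ψ k) (Ψ l) ≠ ⊥) (hsurj : Surjective d)
    {P : SpecialLinearGroup (Fin 2 ⊕ (Σ k, σ k)) ℝ} :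
    P ∈ hodgeGroup (prodPeriod Φ₀ (sigmaPiPeriod Ψ)) ↔ ∃ (M : SL(2, ℝ)) (θ : R → ℝ),
      P = blockDiag (Fin 2) (Σ k, σ k) (M, sigmaBlockDiagSL σ ℝ fun k ↦ hodgeCircleSL (Ψ k) (θ (d k))) := by
  rw [hodgeGroup_prod_sigmaPiPeriod_eq_of_endAlgRat_eq_bot Φ₀ Ψ hE h, Subgroup.mem_map]
  constructor
  · rintro ⟨⟨M, Q⟩, hMQ, rfl⟩
    obtain ⟨θ, hθ⟩ := (mem_hodgeGroup_sigmaPiPeriod_iff_exists_of_homColouring Ψ hg h hd hsurj).1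
      (Subgroup.mem_prod.1 hMQ).2
    exact ⟨M, θ, by rw [← hθ]⟩
  · rintro ⟨M, θ, rfl⟩
    refine ⟨(M, _), Subgroup.mem_prod.2 ⟨?_, sigmaBlockDiagSL_hodgeCircleSL_comp_mem_hodgeGroup_sigmaPiPeriod Ψ
      hg h hd hsurj θ⟩, rfl⟩
    rw [hodgeGroup_eq_top_of_endAlgRat_eq_bot Φ₀ hE]
    exact Subgroup.mem_top M

/-- **COLOURING-FREE FORM: `P ∈ Hg(E × ∏ₖ X_k)(ℝ) ⟺ P = (M 0; 0 diag_k(h_k(e^{iθ_k})))` with `M ∈ SL₂(ℝ)` and `θ_k = θ_l`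
whenever `Hom_ℚ(X_k, X_l) ≠ 0`.** [cite: Imai1976HodgeGroups, §3 Remarks (p. 370 L31–L40)] [cite: MoonenZarhin1999LowDim, §3 Theorem (2)] -/
theorem mem_hodgeGroup_prod_sigmaPiPeriod_iff_exists_of_coe_eq_range (hE : endAlgRat Φ₀ = ⊥)
    (hg : ∀ k, 0 < finrank ℂ (F k))
    (h : ∀ k, (hodgeGroup (Ψ k) : Set (SpecialLinearGroup (σ k) ℝ)) = Set.range (hodgeCircleSL (Ψ k)))
    {P : SpecialLinearGroup (Fin 2 ⊕ (Σ k, σ k)) ℝ} :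
    P ∈ hodgeGroup (prodPeriod Φ₀ (sigmaPiPeriod Ψ)) ↔ ∃ (M : SL(2, ℝ)) (θ : κ → ℝ),
      (∀ k l, homRat (Ψ k) (Ψ l) ≠ ⊥ → θ k = θ l) ∧
        P = blockDiag (Fin 2) (Σ k, σ k) (M, sigmaBlockDiagSL σ ℝ fun k ↦ hodgeCircleSL (Ψ k) (θ k)) := by
  rw [hodgeGroup_prod_sigmaPiPeriod_eq_of_endAlgRat_eq_bot Φ₀ Ψ hE h, Subgroup.mem_map]
  constructor
  · rintro ⟨⟨M, Q⟩, hMQ, rfl⟩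
    obtain ⟨θ, hθ, hQ⟩ := (mem_hodgeGroup_sigmaPiPeriod_iff_exists_of_coe_eq_range Ψ hg h).1 (Subgroup.mem_prod.1 hMQ).2
    exact ⟨M, θ, hθ, by rw [← hQ]⟩
  · rintro ⟨M, θ, hθ, rfl⟩
    refine ⟨(M, _), Subgroup.mem_prod.2 ⟨?_,
      (mem_hodgeGroup_sigmaPiPeriod_iff_exists_of_coe_eq_range Ψ hg h).2 ⟨θ, hθ, rfl⟩⟩, rfl⟩
    rw [hodgeGroup_eq_top_of_endAlgRat_eq_bot Φ₀ hE]
    exact Subgroup.mem_top M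

/-- **WHICH BLOCK-DIAGONAL `(M 0; 0 diag_k(h_k(e^{iθ_k})))` LIE IN `Hg(E × ∏ₖ X_k)(ℝ)`: exactly those with `e^{iθ_k} = e^{iθ_l}`
whenever `Hom_ℚ(X_k, X_l) ≠ 0` — NO condition on `M ∈ SL₂(ℝ)`** (`Hg(E) = SL₂`, and the `Hom`-class condition of g35-#1
on the locus part). [cite: Imai1976HodgeGroups, §2 (p. 368 L5–L7) and §3 Remarks (p. 370 L31–L40)] -/
theorem blockDiag_mem_hodgeGroup_prod_sigmaPiPeriod_iff (hE : endAlgRat Φ₀ = ⊥) (hg : ∀ k, 0 < finrank ℂ (F k))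
    (h : ∀ k, (hodgeGroup (Ψ k) : Set (SpecialLinearGroup (σ k) ℝ)) = Set.range (hodgeCircleSL (Ψ k)))
    (M : SL(2, ℝ)) (θ : κ → ℝ) :
    blockDiag (Fin 2) (Σ k, σ k) (M, sigmaBlockDiagSL σ ℝ fun k ↦ hodgeCircleSL (Ψ k) (θ k)) ∈
        hodgeGroup (prodPeriod Φ₀ (sigmaPiPeriod Ψ)) ↔
      ∀ k l, homRat (Ψ k) (Ψ l) ≠ ⊥ → Complex.exp (θ k * I) = Complex.exp (θ l * I) := by
  rw [hodgeGroup_prod_sigmaPiPeriod_eq_of_endAlgRat_eq_bot Φ₀ Ψ hE h,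
    ← sigmaBlockDiagSL_hodgeCircleSL_mem_hodgeGroup_sigmaPiPeriod_iff Ψ hg h θ]
  constructor
  · rintro ⟨⟨M', Q⟩, hMQ, hPQ⟩
    have hQ : Q = sigmaBlockDiagSL σ ℝ fun k ↦ hodgeCircleSL (Ψ k) (θ k) :=
      (Prod.ext_iff.1 (blockDiag_injective (Fin 2) (Σ k, σ k) hPQ)).2
    exact hQ ▸ (Subgroup.mem_prod.1 hMQ).2
  · intro hQ
    refine Subgroup.mem_map.2 ⟨(M, _), Subgroup.mem_prod.2 ⟨?_, hQ⟩, rfl⟩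
    rw [hodgeGroup_eq_top_of_endAlgRat_eq_bot Φ₀ hE]
    exact Subgroup.mem_top M

end Elements

/-! ## §3 Hodge classes: Künneth with a curve, the colouring count, `D = B` -/

section KunnethCurve

variable (Φ₁ : (Fin 2 → ℝ) ≃L[ℝ] ℂ)
  {ι₂ : Type*} [Fintype ι₂] [DecidableEq ι₂] {E₂ : Type*} [NormedAddCommGroup E₂] [NormedSpace ℂ E₂]
  (Φ₂ : (ι₂ → ℝ) ≃L[ℝ] E₂)

/-- **The Poincaré series of the Hodge classes of `E × X₂`: `P_{E × X₂}(t) = (1 + t) · P_{X₂}(t)`** for a one-dimensional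
`E` with `End_ℚ(E) = ℚ` and any torus `X₂` with commutative `Hg(X₂)(ℂ)` («a tensor product of graded spaces has the product
of the Poincaré series», `P_E(t) = 1 + t`; degree by degree this is the tree's `finrank_hodgeClasses_prod_succ_of_endAlgRat_eq_bot`).
[cite: Gordon1997, §3 Theorem (proof: "`dim Hdg(A) = dim Hdg(B) · dim Hdg(C)`")] [cite: MoonenZarhin1999LowDim, §3 Theorem (2) and (3.1)]
[cite: Lange2023AbelianVarietiesComplex, §7.3.3 Exercise (3)(b)] -/
theorem hodgePoincare_prod_of_endAlgRat_eq_bot (hE : endAlgRat Φ₁ = ⊥)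
    (hcomm : ∀ M N : SpecialLinearGroup ι₂ ℂ, M ∈ hodgeGroupC Φ₂ → N ∈ hodgeGroupC Φ₂ → M.1 * N.1 = N.1 * M.1) :
    hodgePoincare (prodPeriod Φ₁ Φ₂) = (1 + PowerSeries.X) * hodgePoincare Φ₂ := by
  ext p
  cases p with
  | zero =>
    rw [coeff_hodgePoincare, finrank_hodgeClasses_zero_eq_one, add_mul, one_mul, map_add, coeff_hodgePoincare,
      finrank_hodgeClasses_zero_eq_one, PowerSeries.coeff_zero_X_mul, add_zero]
  | succ p =>
    rw [coeff_hodgePoincare, finrank_hodgeClasses_prod_succ_of_endAlgRat_eq_bot Φ₁ Φ₂ hE hcomm, add_mul, one_mul, map_add,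
      PowerSeries.coeff_succ_X_mul, coeff_hodgePoincare, coeff_hodgePoincare]

end KunnethCurve

section HodgeClasses

variable (Φ₀ : (Fin 2 → ℝ) ≃L[ℝ] ℂ)
  {κ : Type*} [Fintype κ] [DecidableEq κ] {σ : κ → Type*} [∀ k, Fintype (σ k)] [∀ k, DecidableEq (σ k)]
  {F : κ → Type*} [∀ k, NormedAddCommGroup (F k)] [∀ k, NormedSpace ℂ (F k)] [∀ k, FiniteDimensional ℂ (F k)]
  (Ψ : ∀ k, (σ k → ℝ) ≃L[ℝ] F k) {R : Type*} [Fintype R] [DecidableEq R] {d : κ → R}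

omit [∀ k, FiniteDimensional ℂ (F k)] in
/-- **`dim_ℚ B^{p+1}(E × ∏ₖ X_k) = dim_ℚ B^{p+1}(∏ₖ X_k) + dim_ℚ B^p(∏ₖ X_k)`** for `E` without complex multiplication and any
finite family on the locus (`Hdg(E × A) = Hdg(E) ⊗ Hdg(A)` with `Hdg(E) = ℚ ⊕ ℚ[pt]`; the tree's two-factor count with its
commutativity hypothesis discharged on the locus). [cite: Gordon1997, §3 Theorem (proof)] [cite: MoonenZarhin1999LowDim, §3 Theorem (2) and (3.1)] -/
theorem finrank_hodgeClasses_prod_sigmaPiPeriod_succ_of_endAlgRat_eq_bot (hE : endAlgRat Φ₀ = ⊥)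
    (h : ∀ k, (hodgeGroup (Ψ k) : Set (SpecialLinearGroup (σ k) ℝ)) = Set.range (hodgeCircleSL (Ψ k))) (p : ℕ) :
    finrank ℚ (hodgeClasses (prodPeriod Φ₀ (sigmaPiPeriod Ψ)) (p + 1)) =
      finrank ℚ (hodgeClasses (sigmaPiPeriod Ψ) (p + 1)) + finrank ℚ (hodgeClasses (sigmaPiPeriod Ψ) p) :=
  finrank_hodgeClasses_prod_succ_of_endAlgRat_eq_bot Φ₀ (sigmaPiPeriod Ψ) hE
    (fun _ _ hM hN ↦ congrArg Subtype.val (hodgeGroupC_sigmaPiPeriod_comm_of_coe_eq_range Ψ h hM hN)) p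

omit [∀ k, FiniteDimensional ℂ (F k)] in
/-- **`P_{E × ∏ X_k}(t) = (1 + t) · P_{∏ X_k}(t)`.** [cite: Gordon1997, §3 Theorem (proof)] [cite: Lange2023AbelianVarietiesComplex, §7.3.3 Exercise (3)(b)] -/
theorem hodgePoincare_prod_sigmaPiPeriod_of_endAlgRat_eq_bot (hE : endAlgRat Φ₀ = ⊥)
    (h : ∀ k, (hodgeGroup (Ψ k) : Set (SpecialLinearGroup (σ k) ℝ)) = Set.range (hodgeCircleSL (Ψ k))) :
    hodgePoincare (prodPeriod Φ₀ (sigmaPiPeriod Ψ)) = (1 + PowerSeries.X) * hodgePoincare (sigmaPiPeriod Ψ) :=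
  hodgePoincare_prod_of_endAlgRat_eq_bot Φ₀ (sigmaPiPeriod Ψ) hE
    fun _ _ hM hN ↦ congrArg Subtype.val (hodgeGroupC_sigmaPiPeriod_comm_of_coe_eq_range Ψ h hM hN)

/-- **WITH A `Hom`-COLOURING `d : κ ↠ R` (`nᵢ = Σ_{d k = i} g_k`):
`dim_ℚ B^{p+1}(E × ∏ₖ X_k) = Σ_{Σf = p+1} ∏ᵢ C(nᵢ, fᵢ)² + Σ_{Σf = p} ∏ᵢ C(nᵢ, fᵢ)²`** — Gordon's count
`dim Hdg(A) = dim Hdg(E) · dim Hdg(∏ X_k)` degree by degree, the locus part by classes (g34-#1).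
[cite: Gordon1997, §3 Theorem (p0013 L55–L62) and its proof (p0013 L84–L90)] [cite: Imai1976HodgeGroups, §3 Remarks (p. 370 L31–L40)] -/
theorem finrank_hodgeClasses_prod_sigmaPiPeriod_succ_eq_sum_of_homColouring (hE : endAlgRat Φ₀ = ⊥)
    (hg : ∀ k, 0 < finrank ℂ (F k))
    (h : ∀ k, (hodgeGroup (Ψ k) : Set (SpecialLinearGroup (σ k) ℝ)) = Set.range (hodgeCircleSL (Ψ k)))
    (hd : ∀ k l, d k = d l ↔ homRat (Ψ k) (Ψ l) ≠ ⊥) (hsurj : Surjective d) (p : ℕ) :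
    finrank ℚ (hodgeClasses (prodPeriod Φ₀ (sigmaPiPeriod Ψ)) (p + 1)) =
      (∑ f ∈ (Finset.univ : Finset R).piAntidiag (p + 1),
          ∏ i, (∑ k ∈ Finset.univ.filter (fun k ↦ d k = i), finrank ℂ (F k)).choose (f i) ^ 2) +
        ∑ f ∈ (Finset.univ : Finset R).piAntidiag p,
          ∏ i, (∑ k ∈ Finset.univ.filter (fun k ↦ d k = i), finrank ℂ (F k)).choose (f i) ^ 2 := by
  rw [finrank_hodgeClasses_prod_sigmaPiPeriod_succ_of_endAlgRat_eq_bot Φ₀ Ψ hE h,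
    finrank_hodgeClasses_sigmaPiPeriod_eq_sum_of_homColouring Ψ hg h hd hsurj,
    finrank_hodgeClasses_sigmaPiPeriod_eq_sum_of_homColouring Ψ hg h hd hsurj]

/-- **`D = B` (TATE) FOR `E × ∏ₖ X_k`**: the rational Hodge classes of the mixed product are polynomials in divisor classes,
in every codimension, for a one-dimensional `E` with `End_ℚ(E) = ℚ` and any finite family on the locus (`D = B` on `E`
trivially, on `∏ₖ X_k` by g33-#8, and the tree's transfer `forall_divisorClasses_prod_eq_hodgeClasses_of_endAlgRat_eq_bot`
with its commutativity hypothesis discharged on the locus). [cite: MoonenZarhin1999LowDim, §3 Theorem (2) ("`X₁ × X₂` again satisfies (D)") and (3.1)]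
[cite: Gordon1997, §3 Theorem (second bullet)] [cite: Lange2023AbelianVarietiesComplex, §7.3.3 Exercise (2)] -/
theorem forall_divisorClasses_prod_sigmaPiPeriod_eq_hodgeClasses (hE : endAlgRat Φ₀ = ⊥) (hg : ∀ k, 0 < finrank ℂ (F k))
    (h : ∀ k, (hodgeGroup (Ψ k) : Set (SpecialLinearGroup (σ k) ℝ)) = Set.range (hodgeCircleSL (Ψ k))) (p : ℕ) :
    divisorClasses (prodPeriod Φ₀ (sigmaPiPeriod Ψ)) p = hodgeClasses (prodPeriod Φ₀ (sigmaPiPeriod Ψ)) p :=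
  forall_divisorClasses_prod_eq_hodgeClasses_of_endAlgRat_eq_bot Φ₀ (sigmaPiPeriod Ψ) hE
    (fun _ _ hM hN ↦ congrArg Subtype.val (hodgeGroupC_sigmaPiPeriod_comm_of_coe_eq_range Ψ h hM hN))
    (fun b ↦ divisorClasses_sigmaPiPeriod_eq_hodgeClasses_of_coe_eq_range Ψ hg h b) p

end HodgeClasses

/-! ## §4 The elliptic curve `E_τ` with `End(E_τ) = ℤ` -/

section EllipticCurve

variable {τ : ℂ} (hτ : τ.im ≠ 0)
  {κ : Type*} [Fintype κ] [DecidableEq κ] {σ : κ → Type*} [∀ k, Fintype (σ k)] [∀ k, DecidableEq (σ k)]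
  {F : κ → Type*} [∀ k, NormedAddCommGroup (F k)] [∀ k, NormedSpace ℂ (F k)] [∀ k, FiniteDimensional ℂ (F k)]
  (Ψ : ∀ k, (σ k → ℝ) ≃L[ℝ] F k) {R : Type*} [Fintype R] [DecidableEq R] {d : κ → R}

omit [∀ k, FiniteDimensional ℂ (F k)] in
/-- **`Hg(E_τ × ∏ₖ X_k)(ℝ) = SL₂(ℝ) × Hg(∏ₖ X_k)(ℝ)` for `End(E_τ) = ℤ`** and any finite family of tori on the locus.
[cite: Imai1976HodgeGroups, §2 Proposition (pp. 368, 370) and §3 Remarks (p. 370)] [cite: MoonenZarhin1999LowDim, §3 Theorem (2)] -/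
theorem hodgeGroup_ellipticPeriod_prod_sigmaPiPeriod_eq_of_eq_bot (hcm : ellipticEnd hτ = ⊥)
    (h : ∀ k, (hodgeGroup (Ψ k) : Set (SpecialLinearGroup (σ k) ℝ)) = Set.range (hodgeCircleSL (Ψ k))) :
    hodgeGroup (prodPeriod (ellipticPeriod hτ) (sigmaPiPeriod Ψ)) =
      ((hodgeGroup (ellipticPeriod hτ)).prod (hodgeGroup (sigmaPiPeriod Ψ))).map (blockDiag (Fin 2) (Σ k, σ k)) :=
  hodgeGroup_prod_sigmaPiPeriod_eq_of_endAlgRat_eq_bot (ellipticPeriod hτ) Ψ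
    ((endAlgRat_ellipticPeriod_eq_bot_iff hτ).2 hcm) h

/-- **`P ∈ Hg(E_τ × ∏ₖ X_k)(ℝ) ⟺ P = (M 0; 0 diag_k(h_k(e^{iθ_{d(k)}})))`, `M ∈ SL₂(ℝ)`, for `End(E_τ) = ℤ`** and a
`Hom`-colouring `d` of the locus factors. [cite: Imai1976HodgeGroups, §3 Remarks (p. 370 L31–L40, p. 371 L5–L7)]
[cite: MoonenZarhin1999LowDim, §3 Theorem (2) and Corollary] -/
theorem mem_hodgeGroup_ellipticPeriod_prod_sigmaPiPeriod_iff_of_eq_bot (hcm : ellipticEnd hτ = ⊥)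
    (hg : ∀ k, 0 < finrank ℂ (F k))
    (h : ∀ k, (hodgeGroup (Ψ k) : Set (SpecialLinearGroup (σ k) ℝ)) = Set.range (hodgeCircleSL (Ψ k)))
    (hd : ∀ k l, d k = d l ↔ homRat (Ψ k) (Ψ l) ≠ ⊥) (hsurj : Surjective d)
    {P : SpecialLinearGroup (Fin 2 ⊕ (Σ k, σ k)) ℝ} :
    P ∈ hodgeGroup (prodPeriod (ellipticPeriod hτ) (sigmaPiPeriod Ψ)) ↔ ∃ (M : SL(2, ℝ)) (θ : R → ℝ),
      P = blockDiag (Fin 2) (Σ k, σ k) (M, sigmaBlockDiagSL σ ℝ fun k ↦ hodgeCircleSL (Ψ k) (θ (d k))) :=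
  mem_hodgeGroup_prod_sigmaPiPeriod_iff_exists_of_homColouring (ellipticPeriod hτ) Ψ
    ((endAlgRat_ellipticPeriod_eq_bot_iff hτ).2 hcm) hg h hd hsurj

/-- **`D = B` for `E_τ × ∏ₖ X_k`, `End(E_τ) = ℤ`**, every codimension. [cite: MoonenZarhin1999LowDim, §3 Theorem (2) and Corollary]
[cite: Gordon1997, §3 Theorem (second bullet)] -/
theorem divisorClasses_ellipticPeriod_prod_sigmaPiPeriod_eq_hodgeClasses (hcm : ellipticEnd hτ = ⊥)
    (hg : ∀ k, 0 < finrank ℂ (F k))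
    (h : ∀ k, (hodgeGroup (Ψ k) : Set (SpecialLinearGroup (σ k) ℝ)) = Set.range (hodgeCircleSL (Ψ k))) (p : ℕ) :
    divisorClasses (prodPeriod (ellipticPeriod hτ) (sigmaPiPeriod Ψ)) p =
      hodgeClasses (prodPeriod (ellipticPeriod hτ) (sigmaPiPeriod Ψ)) p :=
  forall_divisorClasses_prod_sigmaPiPeriod_eq_hodgeClasses (ellipticPeriod hτ) Ψ ((endAlgRat_ellipticPeriod_eq_bot_iff hτ).2 hcm)
    hg h p

end EllipticCurve

end ComplexTorus

end Literature.Geometry.Kaehler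

end
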